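import Summits.ValiantsHypothesis.ValiantsHypothesis.Theorems.RigidityForcesSymmetryGrenetFirstOrderRankRigidOverlapPoint

/-!
# Route RigidityForcesSymmetry — `GrenetFirstOrderRankRigid` (item stmt-ValiantsHypothesis-21029),
line `grenet_gauge`: stub `stub_linearRigid`, step 5 (block I>, part 6) — the snake designs

For the crux line `Cruxes/GrenetFirstOrderRankRigid/Lines/grenet_gauge.lean` (blueprint
`Lines/grenet_gauge-stub_linearRigid-PROOF.md`, §5, type I>, designs I-2 / I-3 / I-5; interface
`Lines/grenet_gauge-stub_linearRigid-BLOCKS.md`).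

Pure combinatorics: the SNAKE DESIGN of an overlap pair.  Data: `U = S + p` (`p ∉ S`), `T` with
`|T| ≤ |S|`, `T ⊄ U`, and a row `p' ∉ T`.  Put `t = |T|`, `s₀ = |S|`, `d = s₀ + 1 - t ≥ 1` (the overlap
is `[t, s₀]`).  Choose `d - 1` distinct MIDDLE rows in `(U \\ T) \\ {p, p'}` (there are enough since
`|U \\ T| ≥ d + 1`) and let `r₀ = p', r₁, …, r_{d-1}` (middle), `r_d = p`.  The snake design is
`d₁ c = r_{c-t+1}`, `d₂ c = r_{c-t}` on the overlap, `d₁` enumerating `U \\ {r₁, …, r_d}` on the levels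
`< t` and `d₂` enumerating `Tᶜ \\ {r₀, …, r_{d-1}}` on the levels `> s₀`.  `exists_overlap_snake` records
its properties: `d₁` is injective on the levels `≤ s₀` with image `U` and `d₁ s₀ = p`; `d₂` is injective
on the levels `≥ t`, avoids `T`, `d₂ t = p'`; consecutive overlap cells dominate each other
(`d₂ c = d₁ (c-1)`, `d₁ c = d₂ (c+1)`); and the END CELLS are dominated when possible: `p'` is swept by
`d₁` before `t` if `p' ∈ U`, `p' ≠ p`, and `p` is swept by `d₂` after `s₀` if `p ∉ T`, `p ≠ p'`.  These
feed `grenet_overlap_PQ_of_design` / `…'` in `…BlockIgt`.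

No new definitions.  VP ≠ VNP is not moved by this file.
-/

noncomputable section

open Finset

namespace Summit.ValiantsHypothesis.Theorems.RigidityForcesSymmetry.GrenetGauge

section Snake

variable {n : ℕ}

/-- **The snake design of an overlap pair** (see the module docstring). [folklore] -/
theorem exists_overlap_snake (S U T : Finset (Fin n)) (p p' : Fin n)
    (hpS : p ∉ S) (hU : insert p S = U) (hp'T : p' ∉ T) (hle : T.card ≤ S.card) (hB : ¬ T ⊆ U) :
    ∃ d₁ d₂ : Fin n → Fin n,
      (∀ c c' : Fin n, (c : ℕ) ≤ S.card → (c' : ℕ) ≤ S.card → d₁ c = d₁ c' → c = c') ∧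
      (univ.filter fun c : Fin n => (c : ℕ) ≤ S.card).image d₁ = U ∧
      (∀ c : Fin n, (c : ℕ) = S.card → d₁ c = p) ∧
      (∀ c c' : Fin n, T.card ≤ (c : ℕ) → T.card ≤ (c' : ℕ) → d₂ c = d₂ c' → c = c') ∧
      (∀ c : Fin n, T.card ≤ (c : ℕ) → d₂ c ∉ T) ∧
      (∀ c : Fin n, (c : ℕ) = T.card → d₂ c = p') ∧
      (∀ c : Fin n, T.card < (c : ℕ) → (c : ℕ) ≤ S.card → ∃ c' : Fin n, (c' : ℕ) ≤ (c : ℕ) ∧ d₁ c' = d₂ c) ∧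
      (∀ c : Fin n, T.card ≤ (c : ℕ) → (c : ℕ) < S.card → ∃ c' : Fin n, (c : ℕ) ≤ (c' : ℕ) ∧ d₂ c' = d₁ c) ∧
      (p' ∈ U → p' ≠ p → ∃ c' : Fin n, (c' : ℕ) < T.card ∧ d₁ c' = p') ∧
      (p ∉ T → p ≠ p' → ∃ c' : Fin n, S.card < (c' : ℕ) ∧ d₂ c' = p) := by
  classical
  -- sizes
  set s₀ := S.card with hs₀
  set t := T.card with ht
  have hUcard : U.card = s₀ + 1 := by rw [← hU, Finset.card_insert_of_notMem hpS]
  have hpU : p ∈ U := by rw [← hU]; exact Finset.mem_insert_self _ _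
  obtain ⟨b₀, hb₀T, hb₀U⟩ := Finset.not_subset.mp hB
  have hUn : s₀ + 1 < n := by
    have h1 : U.card < (univ : Finset (Fin n)).card :=
      Finset.card_lt_card (Finset.ssubset_iff_subset_ne.mpr ⟨Finset.subset_univ _, fun h => hb₀U (h ▸ Finset.mem_univ _)⟩)
    rw [Finset.card_univ, Fintype.card_fin] at h1
    omega
  set dd := s₀ + 1 - t with hdd
  have hdd1 : 1 ≤ dd := by omega
  -- the middle rows
  set A := U \ T with hA
  have hAcard : dd + 1 ≤ A.card := by
    have h1 : A.card + (U ∩ T).card = U.card := by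
      rw [hA]; exact Finset.card_sdiff_add_card_inter U T
    have h2 : (U ∩ T).card < t := by
      rw [ht]
      exact Finset.card_lt_card (Finset.ssubset_iff_subset_ne.mpr ⟨Finset.inter_subset_right,
        fun h => hb₀U (Finset.mem_inter.mp (h.symm ▸ hb₀T)).1⟩)
    omega
  set M := (A.erase p).erase p' with hM
  have hMcard : dd - 1 ≤ M.card := by
    have h1 : A.card - 1 ≤ (A.erase p).card := Finset.pred_card_le_card_erase
    have h2 : (A.erase p).card - 1 ≤ M.card := by rw [hM]; exact Finset.pred_card_le_card_erase
    omega
  have hMmem : ∀ x, x ∈ M → x ≠ p' ∧ x ≠ p ∧ x ∈ U ∧ x ∉ T := fun x hx => by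
    simp only [hM, hA, Finset.mem_erase, Finset.mem_sdiff] at hx
    exact ⟨hx.1, hx.2.1, hx.2.2.1, hx.2.2.2⟩
  obtain ⟨M', hM'M, hM'card⟩ := Finset.exists_subset_card_eq hMcard
  set mid := M'.orderEmbOfFin hM'card with hmid
  have hmidM : ∀ i, mid i ∈ M := fun i => hM'M (Finset.orderEmbOfFin_mem M' hM'card i)
  -- the snake rows `r 0 = p'`, `r a = mid (a-1)` (`0 < a < dd`), `r dd = p`
  set r : ℕ → Fin n := fun a =>
    if h : 0 < a ∧ a < dd then mid ⟨a - 1, by omega⟩ else if a = 0 then p' else p with hr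
  have hr0 : r 0 = p' := by simp [hr]
  have hrdd : ∀ a, dd ≤ a → r a = p := fun a ha => by
    simp only [hr]
    rw [dif_neg (by omega), if_neg (by omega)]
  have hrmid : ∀ a (h : 0 < a ∧ a < dd), r a = mid ⟨a - 1, by omega⟩ := fun a h => by
    simp only [hr]
    rw [dif_pos h]
  have hrU : ∀ a, 0 < a → r a ∈ U := fun a ha => by
    by_cases h : a < dd
    · rw [hrmid a ⟨ha, h⟩]; exact (hMmem _ (hmidM _)).2.2.1
    · rw [hrdd a (by omega)]; exact hpU
  have hrT : ∀ a, a < dd → r a ∉ T := fun a ha => by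
    by_cases h : 0 < a
    · rw [hrmid a ⟨h, ha⟩]; exact (hMmem _ (hmidM _)).2.2.2
    · rw [show a = 0 by omega, hr0]; exact hp'T
  have hrinj1 : ∀ a b, 0 < a → a ≤ dd → 0 < b → b ≤ dd → r a = r b → a = b := by
    intro a b ha1 ha2 hb1 hb2 hab
    by_cases ha : a < dd <;> by_cases hb : b < dd
    · rw [hrmid a ⟨ha1, ha⟩, hrmid b ⟨hb1, hb⟩] at hab
      have := congrArg Fin.val (mid.injective hab)
      simp only at this
      omega
    · exfalso
      rw [hrmid a ⟨ha1, ha⟩, hrdd b (by omega)] at hab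
      exact (hMmem _ (hmidM _)).2.1 hab
    · exfalso
      rw [hrdd a (by omega), hrmid b ⟨hb1, hb⟩] at hab
      exact (hMmem _ (hmidM _)).2.1 hab.symm
    · omega
  have hrinj0 : ∀ a b, a < dd → b < dd → r a = r b → a = b := by
    intro a b ha hb hab
    by_cases ha0 : 0 < a <;> by_cases hb0 : 0 < b
    · rw [hrmid a ⟨ha0, ha⟩, hrmid b ⟨hb0, hb⟩] at hab
      have := congrArg Fin.val (mid.injective hab)
      simp only at this
      omega
    · exfalso
      rw [hrmid a ⟨ha0, ha⟩, show b = 0 by omega, hr0] at hab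
      exact (hMmem _ (hmidM _)).1 hab
    · exfalso
      rw [show a = 0 by omega, hr0, hrmid b ⟨hb0, hb⟩] at hab
      exact (hMmem _ (hmidM _)).1 hab.symm
    · omega
  -- the rows left for the levels `< t` and `> s₀`
  set R1 := (Finset.Icc 1 dd).image r with hR1
  set R0 := (Finset.range dd).image r with hR0
  have hR1card : R1.card = dd := by
    rw [hR1, Finset.card_image_of_injOn fun a ha b hb hab => hrinj1 a b
      (Finset.mem_Icc.mp (Finset.mem_coe.mp ha)).1 (Finset.mem_Icc.mp (Finset.mem_coe.mp ha)).2
      (Finset.mem_Icc.mp (Finset.mem_coe.mp hb)).1 (Finset.mem_Icc.mp (Finset.mem_coe.mp hb)).2 hab,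
      Nat.card_Icc]
    omega
  have hR0card : R0.card = dd := by
    rw [hR0, Finset.card_image_of_injOn fun a ha b hb hab => hrinj0 a b
      (Finset.mem_range.mp (Finset.mem_coe.mp ha)) (Finset.mem_range.mp (Finset.mem_coe.mp hb)) hab,
      Finset.card_range]
  have hR1U : R1 ⊆ U := fun x hx => by
    obtain ⟨a, ha, rfl⟩ := Finset.mem_image.mp hx
    exact hrU a (by have := (Finset.mem_Icc.mp ha).1; omega)
  have hR0T : R0 ⊆ Tᶜ := fun x hx => by
    obtain ⟨a, ha, rfl⟩ := Finset.mem_image.mp hx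
    exact Finset.mem_compl.mpr (hrT a (Finset.mem_range.mp ha))
  set L := U \ R1 with hL
  set Rs := Tᶜ \ R0 with hRs
  have hLcard : L.card = t := by
    have h1 := Finset.card_sdiff_of_subset hR1U
    rw [← hL, hR1card, hUcard] at h1
    omega
  have hRscard : Rs.card = n - s₀ - 1 := by
    have h1 := Finset.card_sdiff_of_subset hR0T
    rw [← hRs, hR0card, Finset.card_compl, Fintype.card_fin] at h1
    omega
  set eL := L.orderEmbOfFin hLcard with heL
  set eR := Rs.orderEmbOfFin hRscard with heR
  have heLmem : ∀ i, eL i ∈ L := fun i => Finset.orderEmbOfFin_mem L hLcard i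
  have heRmem : ∀ i, eR i ∈ Rs := fun i => Finset.orderEmbOfFin_mem Rs hRscard i
  -- the design maps
  refine ⟨fun c => if h : (c : ℕ) < t then eL ⟨c, h⟩ else r ((c : ℕ) - t + 1),
    fun c => if h : s₀ < (c : ℕ) then eR ⟨(c : ℕ) - s₀ - 1, by have := c.isLt; omega⟩ else r ((c : ℕ) - t),
    ?_, ?_, ?_, ?_, ?_, ?_, ?_, ?_, ?_, ?_⟩
  · -- `d₁` injective on the levels `≤ s₀`
    intro c c' hc hc' hcc
    beta_reduce at hcc
    by_cases h1 : (c : ℕ) < t <;> by_cases h2 : (c' : ℕ) < t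
    · rw [dif_pos h1, dif_pos h2] at hcc
      have := congrArg Fin.val (eL.injective hcc)
      exact Fin.ext this
    · exfalso
      rw [dif_pos h1, dif_neg h2] at hcc
      have hm : r ((c' : ℕ) - t + 1) ∈ R1 :=
        Finset.mem_image.mpr ⟨_, Finset.mem_Icc.mpr ⟨by omega, by omega⟩, rfl⟩
      have := heLmem ⟨c, h1⟩
      rw [hcc, hL, Finset.mem_sdiff] at this
      exact this.2 hm
    · exfalso
      rw [dif_neg h1, dif_pos h2] at hcc
      have hm : r ((c : ℕ) - t + 1) ∈ R1 :=
        Finset.mem_image.mpr ⟨_, Finset.mem_Icc.mpr ⟨by omega, by omega⟩, rfl⟩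
      have := heLmem ⟨c', h2⟩
      rw [← hcc, hL, Finset.mem_sdiff] at this
      exact this.2 hm
    · rw [dif_neg h1, dif_neg h2] at hcc
      have := hrinj1 _ _ (by omega) (by omega) (by omega) (by omega) hcc
      exact Fin.ext (by omega)
  · -- image of the levels `≤ s₀` under `d₁` is `U`
    ext x
    simp only [Finset.mem_image, Finset.mem_filter, Finset.mem_univ, true_and]
    constructor
    · rintro ⟨c, hc, rfl⟩
      by_cases h1 : (c : ℕ) < t
      · rw [dif_pos h1]
        have := heLmem ⟨c, h1⟩
        rw [hL, Finset.mem_sdiff] at this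
        exact this.1
      · rw [dif_neg h1]
        exact hrU _ (by omega)
    · intro hx
      by_cases hxR : x ∈ R1
      · obtain ⟨a, ha, rfl⟩ := Finset.mem_image.mp hxR
        obtain ⟨ha1, ha2⟩ := Finset.mem_Icc.mp ha
        obtain ⟨c, hc⟩ : ∃ c : Fin n, (c : ℕ) = t + a - 1 := ⟨⟨t + a - 1, by omega⟩, rfl⟩
        refine ⟨c, by omega, ?_⟩
        rw [dif_neg (by omega)]
        congr 1
        omega
      · have hxL : x ∈ (L : Set (Fin n)) := by
          rw [Finset.mem_coe, hL, Finset.mem_sdiff]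
          exact ⟨hx, hxR⟩
        rw [← Finset.range_orderEmbOfFin L hLcard, Set.mem_range] at hxL
        obtain ⟨c'', hc''⟩ := hxL
        obtain ⟨c, hc⟩ : ∃ c : Fin n, (c : ℕ) = (c'' : ℕ) := ⟨⟨c'', by omega⟩, rfl⟩
        refine ⟨c, by omega, ?_⟩
        rw [dif_pos (by omega)]
        convert hc'' using 2
        exact Fin.ext hc
  · -- top cell of `d₁`
    intro c hc
    beta_reduce
    rw [dif_neg (by omega), show (c : ℕ) - t + 1 = dd by omega]
    exact hrdd dd le_rfl
  · -- `d₂` injective on the levels `≥ t`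
    intro c c' hc hc' hcc
    beta_reduce at hcc
    by_cases h1 : s₀ < (c : ℕ) <;> by_cases h2 : s₀ < (c' : ℕ)
    · rw [dif_pos h1, dif_pos h2] at hcc
      have := congrArg Fin.val (eR.injective hcc)
      simp only at this
      exact Fin.ext (by omega)
    · exfalso
      rw [dif_pos h1, dif_neg h2] at hcc
      have hm : r ((c' : ℕ) - t) ∈ R0 := Finset.mem_image.mpr ⟨_, Finset.mem_range.mpr (by omega), rfl⟩
      have := heRmem ⟨(c : ℕ) - s₀ - 1, by have := c.isLt; omega⟩
      rw [hcc, hRs, Finset.mem_sdiff] at this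
      exact this.2 hm
    · exfalso
      rw [dif_neg h1, dif_pos h2] at hcc
      have hm : r ((c : ℕ) - t) ∈ R0 := Finset.mem_image.mpr ⟨_, Finset.mem_range.mpr (by omega), rfl⟩
      have := heRmem ⟨(c' : ℕ) - s₀ - 1, by have := c'.isLt; omega⟩
      rw [← hcc, hRs, Finset.mem_sdiff] at this
      exact this.2 hm
    · rw [dif_neg h1, dif_neg h2] at hcc
      have := hrinj0 _ _ (by omega) (by omega) hcc
      exact Fin.ext (by omega)
  · -- `d₂` avoids `T` on the levels `≥ t`
    intro c hc
    beta_reduce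
    by_cases h1 : s₀ < (c : ℕ)
    · rw [dif_pos h1]
      have := heRmem ⟨(c : ℕ) - s₀ - 1, by have := c.isLt; omega⟩
      rw [hRs, Finset.mem_sdiff, Finset.mem_compl] at this
      exact this.1
    · rw [dif_neg h1]
      exact hrT _ (by omega)
  · -- bottom cell of `d₂`
    intro c hc
    beta_reduce
    rw [dif_neg (by omega), show (c : ℕ) - t = 0 by omega]
    exact hr0
  · -- forward domination inside the overlap
    intro c hc1 hc2
    obtain ⟨c', hc'⟩ : ∃ c' : Fin n, (c' : ℕ) = (c : ℕ) - 1 := ⟨⟨(c : ℕ) - 1, by omega⟩, rfl⟩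
    refine ⟨c', by omega, ?_⟩
    beta_reduce
    rw [dif_neg (by omega), dif_neg (by omega)]
    congr 1
    omega
  · -- backward domination inside the overlap
    intro c hc1 hc2
    obtain ⟨c', hc'⟩ : ∃ c' : Fin n, (c' : ℕ) = (c : ℕ) + 1 := ⟨⟨(c : ℕ) + 1, by omega⟩, rfl⟩
    refine ⟨c', by omega, ?_⟩
    beta_reduce
    rw [dif_neg (by omega), dif_neg (by omega)]
    congr 1
    omega
  · -- the end cell `p'` is swept by `d₁` before `t` when `p' ∈ U`, `p' ≠ p`
    intro hp'U hp'p
    have hp'R1 : p' ∉ R1 := by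
      intro h
      obtain ⟨a, ha, hpa⟩ := Finset.mem_image.mp h
      obtain ⟨ha1, ha2⟩ := Finset.mem_Icc.mp ha
      by_cases h' : a < dd
      · rw [hrmid a ⟨by omega, h'⟩] at hpa
        exact (hMmem _ (hmidM _)).1 hpa
      · rw [hrdd a (by omega)] at hpa
        exact hp'p hpa.symm
    have hxL : p' ∈ (L : Set (Fin n)) := by
      rw [Finset.mem_coe, hL, Finset.mem_sdiff]
      exact ⟨hp'U, hp'R1⟩
    rw [← Finset.range_orderEmbOfFin L hLcard, Set.mem_range] at hxL
    obtain ⟨c'', hc''⟩ := hxL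
    obtain ⟨c, hc⟩ : ∃ c : Fin n, (c : ℕ) = (c'' : ℕ) := ⟨⟨c'', by omega⟩, rfl⟩
    refine ⟨c, by omega, ?_⟩
    beta_reduce
    rw [dif_pos (by omega)]
    convert hc'' using 2
    exact Fin.ext hc
  · -- the end cell `p` is swept by `d₂` after `s₀` when `p ∉ T`, `p ≠ p'`
    intro hpT hpp'
    have hpR0 : p ∉ R0 := by
      intro h
      obtain ⟨a, ha, hpa⟩ := Finset.mem_image.mp h
      have ha' := Finset.mem_range.mp ha
      by_cases h' : 0 < a
      · rw [hrmid a ⟨h', ha'⟩] at hpa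
        exact (hMmem _ (hmidM _)).2.1 hpa
      · rw [show a = 0 by omega, hr0] at hpa
        exact hpp' hpa.symm
    have hxR : p ∈ (Rs : Set (Fin n)) := by
      rw [Finset.mem_coe, hRs, Finset.mem_sdiff, Finset.mem_compl]
      exact ⟨hpT, hpR0⟩
    rw [← Finset.range_orderEmbOfFin Rs hRscard, Set.mem_range] at hxR
    obtain ⟨c'', hc''⟩ := hxR
    obtain ⟨c, hc⟩ : ∃ c : Fin n, (c : ℕ) = s₀ + 1 + (c'' : ℕ) := ⟨⟨s₀ + 1 + c'', by omega⟩, rfl⟩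
    refine ⟨c, by omega, ?_⟩
    beta_reduce
    rw [dif_pos (by omega)]
    convert hc'' using 2
    exact Fin.ext (show (c : ℕ) - s₀ - 1 = (c'' : ℕ) by omega)

end Snake

end Summit.ValiantsHypothesis.Theorems.RigidityForcesSymmetry.GrenetGauge
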